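import Summits.BirchSwinnertonDyer.Rank1Residual.Additive.LocalSubgroupTransport
import HarnessLib

/-!
# Route `SignedLowerHalves`, crux L `SmallImageLowerHalfBothSigns` (stmt-BirchSwinnertonDyer-23599), line `rtt_w3` v11 — brick D3-W, CONCRETE HALF,
# part 2 (memo `Lines/rtt_w3-MEMO-D3c-w3g17.md` §2/§5, HELPER-TABLE v11 rows D3-W-a/c): KUMMER WITNESSES CROSS THE LOCAL BASE-CHANGE SQUARE —
# a `K`-side Kummer witness `τ' ↦ τ'•Q_K − Q_K` for a function `F_K` on `Γ_{K_n}` that is the base change of a `k`-side function `F` becomes,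
# through the tree's transport `(transportHom, transportPoints)` (cell b2b, `Rank1Residual/Additive/LocalSubgroupTransport`), the `k`-side Kummer
# witness `τ ↦ τ•Q − Q` with `Q = transportPoints Q_K` — i.e. the hypothesis `hψ` of ★★ `mem_localKummerOverOfEmb_of_kummer_on_index_two`
# (p765485) on the sub-local-group where the transport is defined, with `p^k Q ∈ A' := transportPoints(A_K)`.

Width seat `bsd-line-slh-p3-w3` g17 under LEAD `cruxlead-stmt-BirchSwinnertonDyer-23599` (cell `bsd-ssimc`; `--supports stmt-BirchSwinnertonDyer-23599 --as helper`).
THEOREMS ONLY (no definition, no named fact, no instance, no `sorry`); data and hypotheses EXACTLY those of `LocalSubgroupTransport`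
(`k ⊆ K` algebraic, `E ⊇ k`, `E' ⊇ K`, `ι, ι₂, ι', hcompat, hfix`, subgroups `H ≤ Γ_k`, `H' ≤ Γ_K` with `res⁻¹ H ≤ H'`, a continuous section
`Θ : H → H'` of `res`). Nothing is instantiated at the completions; BSD / crux L are NOT proved here.

* ★ `pointsMapOfEmb_eq_smul_transportPoints_sub` — if `F_K ∘ Θ = (E[p^∞] ≃ E_K[p^∞]) ∘ F` on `H` and `ι'_*(F_K(τ'|)) = τ'•Q_K − Q_K` on the
  `K`-side local group, then `ι_*(F(τ|)) = τ•(transportPoints Q_K) − transportPoints Q_K` on the `k`-side local group `localSubgroupOfEmb H ι`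
  (`transportPoints_pointsMapOfEmb`, `res_{ι'} ∘ transportHom = Θ ∘ res_ι`, `transportPoints_smul`).
* `nsmul_transportPoints_mem_map` — `p^k • transportPoints Q_K ∈ A_K.map transportPoints` when `p^k • Q_K ∈ A_K`.
* ★ `exists_kummer_witness_transport` — packaged: the `k`-side Kummer datum `(Q, k)` with `p^k Q ∈ A_K.map transportPoints`.

References: [SerreGaloisCohomology1997] I §2.4, II §1.1; [Kobayashi2003] Def. 1.1 (the Kummer condition at the place above `p`).
-/

set_option autoImplicit false
set_option linter.dupNamespace false -- D-0017: single-problem summit, the namespace repeats the problem name by design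
noncomputable section

open scoped Classical

universe u

namespace Summit.BirchSwinnertonDyer.BirchSwinnertonDyer.Theorems.SmallImageCharSignedSelmer

open Literature.NumberTheory.EllipticCurves Literature.NumberTheory.GaloisRepresentations Field
  Summit.BirchSwinnertonDyer.Rank1Residual.Additive.LocalTransport

section KummerTransport

variable {k : Type u} [Field k] (K : Type u) [Field K] [Algebra k K] [Algebra.IsAlgebraic k K]
  (H : Subgroup (absoluteGaloisGroup k)) (H' : Subgroup (absoluteGaloisGroup K))
  (hHH' : ∀ τ : absoluteGaloisGroup K, resGal (K := k) K τ ∈ H → τ ∈ H')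
  {E : Type u} [Field E] [Algebra k E] {E' : Type u} [Field E'] [Algebra K E'] [Algebra k E'] [IsScalarTower k K E']
  (ι : AlgebraicClosure k →ₐ[k] AlgebraicClosure E) (ι₂ : AlgebraicClosure E ≃+* AlgebraicClosure E')
  (ι' : AlgebraicClosure K →ₐ[K] AlgebraicClosure E')
  (hcompat : ∀ z : AlgebraicClosure k, ι' (closureEmb (K := k) K z) = ι₂ (ι z))
  (hfix : ∀ h : absoluteGaloisGroup E, resGalOfEmb ι h ∈ H → ∀ y : E',
    (show AlgebraicClosure E ≃ₐ[E] AlgebraicClosure E from h) (ι₂.symm (algebraMap E' (AlgebraicClosure E') y)) =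
      ι₂.symm (algebraMap E' (AlgebraicClosure E') y))
  (Θ : H →ₜ* H') (hΘ : ∀ τ : H, resGal (K := k) K (Θ τ : absoluteGaloisGroup K) = τ)
  (W : WeierstrassCurve k) (p : ℕ)

include hHH' hfix hΘ in
/-- ★ **A `K`-side Kummer witness transports to a `k`-side Kummer witness.** Let `F : H → E[p^∞]` and `F_K : H' → E_K[p^∞]` with
`F_K(Θ x) = (E[p^∞] ≃ E_K[p^∞])(F x)`, and suppose `ι'_*(F_K(τ'|_{K̄})) = τ' • Q_K − Q_K` for every `τ'` of the `K`-side local group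
`localSubgroupOfEmb H' ι'`. Then for every `τ` of the `k`-side local group `localSubgroupOfEmb H ι`:
`ι_*(F(τ|_{k̄})) = τ • transportPoints Q_K − transportPoints Q_K`. In D3-W (`k = ℚ`, `H = Γ_{ℚ_n} ⊓ galRange K`, `H' = Γ_{K_n}`): the `K`-side
carrier witness yields the hypothesis `hψ` of p765485 on `Λ'`. [cite: SerreGaloisCohomology1997, II §1.1] [cite: Kobayashi2003, Def. 1.1] -/
theorem pointsMapOfEmb_eq_smul_transportPoints_sub (F : H → W.geomPrimaryTorsion p)
    (F_K : H' → (W.baseChange K).geomPrimaryTorsion p) (hFF : ∀ x : H, F_K (Θ x) = primaryBaseChangeEquiv K W p (F x))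
    (Q_K : localPoints (W.baseChange K) E')
    (hQ : ∀ τ' : localSubgroupOfEmb H' ι',
      pointsMapOfEmb (W.baseChange K) ι' ((F_K (resGalSubgroupOfEmb H' ι' τ') : (W.baseChange K).geomPrimaryTorsion p) :
        (W.baseChange K).geomPoints) = (τ' : absoluteGaloisGroup E') • Q_K - Q_K)
    (τ : localSubgroupOfEmb H ι) :
    pointsMapOfEmb W ι ((F (resGalSubgroupOfEmb H ι τ) : W.geomPrimaryTorsion p) : W.geomPoints) =
      (τ : absoluteGaloisGroup E) • transportPoints K ι ι₂ ι' hcompat W Q_K - transportPoints K ι ι₂ ι' hcompat W Q_K := by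
  have hres : resGalSubgroupOfEmb H' ι' (transportHom K H H' hHH' ι ι₂ ι' hcompat hfix τ) = Θ (resGalSubgroupOfEmb H ι τ) := by
    have h := resGalSubgroupOfEmb_comp_transportHom K H H' hHH' ι ι₂ ι' hcompat hfix Θ hΘ
    exact congrArg (fun f : localSubgroupOfEmb H ι →ₜ* H' ↦ f τ) h
  rw [← transportPoints_pointsMapOfEmb K ι ι₂ ι' hcompat W p (F (resGalSubgroupOfEmb H ι τ)), ← hFF, ← hres,
    hQ (transportHom K H H' hHH' ι ι₂ ι' hcompat hfix τ), map_sub, ← Subgroup.smul_def,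
    transportPoints_smul K H H' hHH' ι ι₂ ι' hcompat hfix W τ Q_K, Subgroup.smul_def]

omit [Algebra.IsAlgebraic k K] in
/-- `p^k • transportPoints Q_K` lies in the transported point group when `p^k • Q_K ∈ A_K`. [cite: Kobayashi2003, Def. 1.1] -/
theorem nsmul_transportPoints_mem_map (A_K : AddSubgroup (localPoints (W.baseChange K) E')) {Q_K : localPoints (W.baseChange K) E'} {n : ℕ}
    (hQ : n • Q_K ∈ A_K) : n • transportPoints K ι ι₂ ι' hcompat W Q_K ∈ A_K.map (transportPoints K ι ι₂ ι' hcompat W) := by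
  rw [← map_nsmul]
  exact AddSubgroup.mem_map_of_mem _ hQ

include hHH' hfix hΘ in
/-- ★ **Packaged `k`-side Kummer datum from a `K`-side one.** Under the hypotheses of `pointsMapOfEmb_eq_smul_transportPoints_sub` with
`p^n • Q_K ∈ A_K`: there is `Q ∈ E(Ē)` with `p^n • Q ∈ A_K.map transportPoints` and `ι_*(F(τ|)) = τ•Q − Q` on `localSubgroupOfEmb H ι`
(namely `Q = transportPoints Q_K`). In D3-W this is the pair `(Q', k')` + `hψ` of p765485 with `A' := A_K.map transportPoints`,
`A_K = E^ε(K_n·K_v)`. [cite: SerreGaloisCohomology1997, II §1.1] [cite: Kobayashi2003, Def. 1.1] -/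
theorem exists_kummer_witness_transport (F : H → W.geomPrimaryTorsion p)
    (F_K : H' → (W.baseChange K).geomPrimaryTorsion p) (hFF : ∀ x : H, F_K (Θ x) = primaryBaseChangeEquiv K W p (F x))
    (A_K : AddSubgroup (localPoints (W.baseChange K) E')) (Q_K : localPoints (W.baseChange K) E') (n : ℕ) (hQA : p ^ n • Q_K ∈ A_K)
    (hQ : ∀ τ' : localSubgroupOfEmb H' ι',
      pointsMapOfEmb (W.baseChange K) ι' ((F_K (resGalSubgroupOfEmb H' ι' τ') : (W.baseChange K).geomPrimaryTorsion p) :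
        (W.baseChange K).geomPoints) = (τ' : absoluteGaloisGroup E') • Q_K - Q_K) :
    ∃ Q : localPoints W E, p ^ n • Q ∈ A_K.map (transportPoints K ι ι₂ ι' hcompat W) ∧
      ∀ τ : localSubgroupOfEmb H ι,
        pointsMapOfEmb W ι ((F (resGalSubgroupOfEmb H ι τ) : W.geomPrimaryTorsion p) : W.geomPoints) =
          (τ : absoluteGaloisGroup E) • Q - Q :=
  ⟨transportPoints K ι ι₂ ι' hcompat W Q_K, nsmul_transportPoints_mem_map K ι ι₂ ι' hcompat W A_K hQA,
    pointsMapOfEmb_eq_smul_transportPoints_sub K H H' hHH' ι ι₂ ι' hcompat hfix Θ hΘ W p F F_K hFF Q_K hQ⟩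

end KummerTransport

end Summit.BirchSwinnertonDyer.BirchSwinnertonDyer.Theorems.SmallImageCharSignedSelmer

end
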